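import Summits.Ventures.YMGap.Conjectures.StrongCouplingSUNChiralLROMesonWeightRPBeta
import Summits.Ventures.YMGap.Conjectures.StrongCouplingSUNChiralLROMesonWeightSymmetryBeta
import HarnessLib
import HarnessLib.Audit.Tags

/-!
# The infrared bound (IR)_{β,4N} for `SU(N)` at every `β ≥ 0`, and the reduction of «`SU(N)`, small
# `β > 0`, chiral long-range order» to the Schwinger–Dyson bound

Cell `pub-ymgap`, seat qcd-lit g26 (literature-prover), `bears_on: Q1` — WHAT THE `SU(N)` EXTENSION OF
SALMHOFER–SEILER §5 p. 424 NEEDS AT `β > 0`, as Lean theorems.  Everything is a theorem (0 facts, 0 sorry).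

* **`infraredBound_SUB'`** — for every `N ≥ 1`, `β ≥ 0` with `Z_β ≠ 0`, even `L`:
  `2(ν ∓ C(χ))(±T̂_β(χ)) ≤ 4N` at every character, for the kernel `T_β(x,y) = ⟨ψ̄ψ(x)ψ̄ψ(y)⟩_β` of `SU(N)`
  lattice gauge theory with one massless staggered fermion antiperiodic in all directions (Wilson plaquette
  action at coupling `β`): reflection positivity of the `β`-dressed background weight for every plane
  (`isRPWeight_bgWeightNSUB`), Gaussian domination for general weights (`ComplexSpinRPWeightInfraredBound`),
  lattice symmetries (`…SymmetryBeta`).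
* **`chiralLRO_SU_of_SD`** — THE REDUCTION: a volume-uniform Schwinger–Dyson lower bound
  `∑_μ(T_β(0,e_μ)+T_β(0,−e_μ)) ≥ b` with `2·4N·S(ν) < b` on `0 ≤ β < β₀` implies chiral long-range order
  `|Λ|⁻¹∑_x T_β(0,x) ≥ c > 0` on `0 ≤ β < β₀`, uniformly in `L` (`ν ≥ 4`; `Z_β ≠ 0` follows from the bound).
  At `β = 0`, `N` odd `≥ 3`, the Schwinger–Dyson bound is the theorem `sum_suTwoPoint_nbr_ge` and the
  conclusion is `chiralLRO_SU`; at `β > 0` it is the one missing input (no proof in print; the `U(N)` one-link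
  argument of `…SchwingerDysonSmallBeta` does not cover the baryon loops).

Honest framing: finite even torus uniformly in `L`; nothing about the thermodynamic or continuum limit,
several flavours, or the summit's `QCD` conjunct; COUNT unmoved.

## References
* [SalmhoferSeiler1991] M. Salmhofer, E. Seiler, Commun. Math. Phys. 139 (1991) 395–432, Thm. 3.21
  (3.112)–(3.113), (3.100)–(3.106), Thm. 4.8, Cor. 4.9 (4.41)–(4.42), Remark 4.5, §5 p. 424.
-/

noncomputable section

open MeasureTheory Finset MvPolynomial
open scoped ComplexConjugate BigOperators ComplexOrder
open Literature.MathematicalPhysics.QuantumFieldTheory (Site Edge GaugeConfig)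
open Literature.MathematicalPhysics.QuantumFieldTheory.WilsonRP
open Literature.MathematicalPhysics.QuantumLattice
open Literature.MathematicalPhysics.QuantumLattice.GrassmannAlgebra
open Literature.MathematicalPhysics.QuantumLattice.StrongCoupling
open Literature.MathematicalPhysics.QuantumLattice.StaggeredRP (thetaT posAlg posSites IsPosSite gaussCorrN HermSqCert)
open Literature.MathematicalPhysics.StatisticalMechanics
open Literature.MathematicalPhysics.StatisticalMechanics.ComplexSpin
open Literature.Barriers.CriticalPhenomena.NonGibbs
open Literature.Probability.LatticeModels (TorusSite)

namespace Summit.Ventures.YMGap.Conjectures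

namespace MesonWeightSU

open MesonWeight SchwingerDyson

variable {N ν L : ℕ} [NeZero ν] [NeZero L] [LinearOrder (TorusSite ν L)]

/-! ### Every plane at `β ≥ 0`, given the lattice symmetries; the infrared bound at `β` -/

/-- **The `β`-dressed background weight is a reflection-positive weight for EVERY plane** (`β ≥ 0`, `Z_β ≠ 0`),
given the invariance of the moments under translations (`hT`) and axis transpositions (`hP`). [cite: SalmhoferSeiler1991, Remark 4.5 and (3.90)–(3.93)] -/
theorem isRPWeight_bgWeightNSUB (hN0 : N ≠ 0) (hL : Even L) {β : ℝ} (hβ : 0 ≤ β) (hZ : suJB N ν L β 1 ≠ 0)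
    (hT : ∀ (c : TorusSite ν L) (m : TorusSite ν L →₀ ℕ),
      mesonMomentSUB N ν L β (Finsupp.mapDomain (Equiv.addRight c) m) = mesonMomentSUB N ν L β m)
    (hP : ∀ (i : Fin ν) (m : TorusSite ν L →₀ ℕ),
      mesonMomentSUB N ν L β (Finsupp.mapDomain (axisSwap i) m) = mesonMomentSUB N ν L β m)
    (ε : ℤ) (i : Fin ν) (k : ZMod L) : IsRPWeight i k N (bgWeightNSUB N ν L ε β) := by
  refine isRPWeight_of_conj i k (planeConj i k) (siteReflect_planeConj i k) (planeConj_mem_halfPlus i k)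
    ?_ ?_ ?_ (isRPWeight_bgWeightNSUB_zero_one hN0 hL hβ hZ ε)
  · rw [bgWeightNSUB, map_mul, map_mul, map_conj_mesonWeightCSUB hL, map_conj_siteFactorN, map_conj_bondFactorN]
  · rw [bgWeightNSUB, map_mul, map_mul, rename_bondFactorN_planeConj, rename_siteFactorN,
      rename_mesonWeightCSUB β (planeConj i k) fun m => by
        rw [planeConj, Equiv.coe_trans, Finsupp.mapDomain_comp, hT, hP]]
  · rw [bgWeightNSUB, map_mul, map_mul, rename_siteReflect_mesonWeightCSUB hL hβ hZ, rename_siteReflect_siteFactorN hL,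
      rename_siteReflect_bondFactorN hL]

/-- Translation invariance of `[σ_xσ_y]_{W_β}` from that of the moments. [cite: SalmhoferSeiler1991, (3.100)] -/
theorem twoPtWR_mesonWeightSUB_add (hL : Even L) (β : ℝ)
    (hT : ∀ (c : TorusSite ν L) (m : TorusSite ν L →₀ ℕ),
      mesonMomentSUB N ν L β (Finsupp.mapDomain (Equiv.addRight c) m) = mesonMomentSUB N ν L β m)
    (x y c : TorusSite ν L) :
    twoPtWR N (mesonWeightSUB N ν L β) (x + c) (y + c) = twoPtWR N (mesonWeightSUB N ν L β) x y := by
  apply Complex.ofReal_injective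
  rw [twoPtWR, twoPtWR, ← bracketW_map_map, ← bracketW_map_map, map_mesonWeightSUB hL, map_mul, map_mul,
    map_X, map_X, map_X, map_X,
    show (X (x + c) * X (y + c) : FieldAlg ν L) =
        monomial (Finsupp.mapDomain (Equiv.addRight c) (Finsupp.single x 1 + Finsupp.single y 1)) 1 by
      rw [Finsupp.mapDomain_add, Finsupp.mapDomain_single, Finsupp.mapDomain_single, Equiv.coe_addRight,
        X, X, monomial_mul, mul_one],
    show (X x * X y : FieldAlg ν L) = monomial (Finsupp.single x 1 + Finsupp.single y 1) 1 by
      rw [X, X, monomial_mul, mul_one],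
    bracketW_mesonWeightCSUB_monomial, bracketW_mesonWeightCSUB_monomial, hT]

/-- `[1]_{W_β} > 0` when `Z_β ≠ 0`. [cite: SalmhoferSeiler1991, §2 (2.11)] -/
theorem bracketWR_mesonWeightSUB_one_pos (hL : Even L) (β : ℝ) (hZ : suJB N ν L β 1 ≠ 0) :
    0 < bracketWR N (mesonWeightSUB N ν L β) 1 := by
  refine lt_of_le_of_ne (bracketWR_mesonWeightSUB_one_nonneg hL β) fun h0 => ?_
  have h := bracketWR_mesonWeightSUB_one (N := N) (ν := ν) hL β
  rw [← h0, Complex.ofReal_zero] at h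
  have hs : chiralSign (N := N) (evens ν L) ≠ 0 := fun hs0 => by
    have := chiralSign_mul_self (N := N) (evens ν L); rw [hs0, zero_mul] at this; exact zero_ne_one this
  exact mul_ne_zero hs hZ h.symm

/-- **(IR)_{β,4N} FOR THE `SU(N)` THEORY AT EVERY `β ≥ 0` WITH `Z_β ≠ 0`, UNIFORMLY IN THE VOLUME**, given the
lattice symmetries of the `β`-dressed moments. [cite: SalmhoferSeiler1991, Thm. 3.21 with (3.112)–(3.113), Remark 4.5 and §5 p. 424] -/
theorem infraredBound_SUB (hN0 : N ≠ 0) (hL : Even L) {β : ℝ} (hβ : 0 ≤ β) (hZ : suJB N ν L β 1 ≠ 0)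
    (hT : ∀ (c : TorusSite ν L) (m : TorusSite ν L →₀ ℕ),
      mesonMomentSUB N ν L β (Finsupp.mapDomain (Equiv.addRight c) m) = mesonMomentSUB N ν L β m)
    (hP : ∀ (i : Fin ν) (m : TorusSite ν L →₀ ℕ),
      mesonMomentSUB N ν L β (Finsupp.mapDomain (axisSwap i) m) = mesonMomentSUB N ν L β m)
    (χ : AddChar (TorusSite ν L) ℂ) :
    2 * ((ν : ℝ) - cosSum χ) * (kernelSymbol (fun x y => suTwoPointB N ν L β x y) χ).re ≤ 4 * N ∧
      2 * ((ν : ℝ) + cosSum χ) * (-(kernelSymbol (fun x y => suTwoPointB N ν L β x y) χ).re) ≤ 4 * N := by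
  have hN1 : 1 ≤ N := Nat.one_le_iff_ne_zero.2 hN0
  have hL2 : 2 ≤ L := by obtain ⟨k, hk⟩ := hL; have := NeZero.ne L; omega
  have hcard : 2 ≤ Fintype.card (TorusSite ν L) := by
    rw [Fintype.card_fun, ZMod.card, Fintype.card_fin]
    calc 2 ≤ L := hL2
      _ ≤ L ^ ν := Nat.le_self_pow (NeZero.ne ν) L
  set W₀ := mesonWeightSUB N ν L β with hW₀
  have hW : ∀ (ε : ℤ) (i : Fin ν) (k : ZMod L), IsRPWeight i k N (bgWeightNSUB N ν L ε β) :=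
    fun ε i k => isRPWeight_bgWeightNSUB hN0 hL hβ hZ hT hP ε i k
  have hbg : ∀ ε : ℤ, TruncEq N (gaussFactor ε N * bgWeightNSUB N ν L ε β) (MvPolynomial.map Complex.ofRealHom W₀) := by
    intro ε
    rw [hW₀, map_mesonWeightSUB hL]
    exact truncEq_gaussFactor_mul_bgWeightNSUB hcard ε β
  have hTinv : ∀ x y c : TorusSite ν L, twoPtWR N W₀ (x + c) (y + c) = twoPtWR N W₀ x y :=
    twoPtWR_mesonWeightSUB_add hL β hT
  have e1 := twoPtWR_mode_le hL (0 : Fin ν) hcard hN1 (hW 1) (hbg 1) hTinv χ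
  have e2 := neg_twoPtWR_mode_le hL (0 : Fin ν) hcard hN1 (hW (-1)) (hbg (-1)) hTinv χ
  set Z := bracketWR N W₀ 1 with hZdef
  have hZp : 0 < Z := bracketWR_mesonWeightSUB_one_pos hL β hZ
  have hNpos : (0 : ℝ) < N := by exact_mod_cast hN1
  have hker : (fun x y => suTwoPointB N ν L β x y) = fun x y => ((2 * N : ℝ) ^ 2 / Z) * twoPtWR N W₀ x y := by
    funext x y
    rw [suTwoPointB_eq_twoPtWR_div hN0 hL]
    ring
  have hsym : (kernelSymbol (fun x y => suTwoPointB N ν L β x y) χ).re =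
      ((2 * N : ℝ) ^ 2 / Z) * (kernelSymbol (twoPtWR N W₀) χ).re := by
    rw [hker, kernelSymbol_const_mul, Complex.re_ofReal_mul]
  have hc : 0 < (2 * N : ℝ) ^ 2 / Z := by positivity
  have hkey : (2 * N : ℝ) ^ 2 / Z * (1 / N * Z) = 4 * N := by
    field_simp
    ring
  constructor
  · rw [hsym]
    calc 2 * ((ν : ℝ) - cosSum χ) * ((2 * N : ℝ) ^ 2 / Z * (kernelSymbol (twoPtWR N W₀) χ).re)
        = (2 * N : ℝ) ^ 2 / Z * (2 * ((ν : ℝ) - cosSum χ) * (kernelSymbol (twoPtWR N W₀) χ).re) := by ring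
      _ ≤ (2 * N : ℝ) ^ 2 / Z * (1 / N * Z) := mul_le_mul_of_nonneg_left e1 hc.le
      _ = 4 * N := hkey
  · rw [hsym]
    calc 2 * ((ν : ℝ) + cosSum χ) * -((2 * N : ℝ) ^ 2 / Z * (kernelSymbol (twoPtWR N W₀) χ).re)
        = (2 * N : ℝ) ^ 2 / Z * (2 * ((ν : ℝ) + cosSum χ) * -(kernelSymbol (twoPtWR N W₀) χ).re) := by ring
      _ ≤ (2 * N : ℝ) ^ 2 / Z * (1 / N * Z) := mul_le_mul_of_nonneg_left e2 hc.le
      _ = 4 * N := hkey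

/-- **(IR)_{β,4N} FOR `SU(N)` (EVERY `N ≥ 1`), ONE MASSLESS STAGGERED FLAVOUR ANTIPERIODIC IN ALL DIRECTIONS,
AT EVERY `β ≥ 0` WITH `Z_β ≠ 0`, UNIFORMLY IN THE EVEN VOLUME** — Salmhofer–Seiler's (3.112)–(3.113) for the
`SU(N)` kernel `T_β(x,y) = ⟨ψ̄ψ(x)ψ̄ψ(y)⟩_{β}`; the lattice symmetries are discharged by
`…SUNChiralLROMesonWeightSymmetryBeta`. [cite: SalmhoferSeiler1991, Thm. 3.21 with (3.112)–(3.113), Remark 4.5 and §5 p. 424] -/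
theorem infraredBound_SUB' (hN0 : N ≠ 0) (hL : Even L) {β : ℝ} (hβ : 0 ≤ β) (hZ : suJB N ν L β 1 ≠ 0)
    (χ : AddChar (TorusSite ν L) ℂ) :
    2 * ((ν : ℝ) - cosSum χ) * (kernelSymbol (fun x y => suTwoPointB N ν L β x y) χ).re ≤ 4 * N ∧
      2 * ((ν : ℝ) + cosSum χ) * (-(kernelSymbol (fun x y => suTwoPointB N ν L β x y) χ).re) ≤ 4 * N :=
  infraredBound_SUB hN0 hL hβ hZ (fun c m => mesonMomentSUB_mapDomain_addRight hL hZ c m)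
    (fun i m => mesonMomentSUB_mapDomain_axisSwap hL hZ i m) χ

/-- **Translation invariance of the kernel at `β`** (`Z_β ≠ 0`). [cite: SalmhoferSeiler1991, (3.100)] -/
theorem suTwoPointB_add (hN0 : N ≠ 0) (hL : Even L) {β : ℝ} (hZ : suJB N ν L β 1 ≠ 0) (x y c : TorusSite ν L) :
    suTwoPointB N ν L β (x + c) (y + c) = suTwoPointB N ν L β x y := by
  rw [suTwoPointB_eq_twoPtWR_div hN0 hL, suTwoPointB_eq_twoPtWR_div hN0 hL,
    twoPtWR_mesonWeightSUB_add hL β (fun c m => mesonMomentSUB_mapDomain_addRight hL hZ c m)]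

/-- A Schwinger–Dyson lower bound with `b > 0` forces `Z_β ≠ 0` (the junk kernel of `Z_β = 0` is `0`). [cite: SalmhoferSeiler1991, Thm 4.8 (4.38)] -/
theorem suJB_one_ne_zero_of_SD {β b : ℝ} (hb : 0 < b)
    (hSD : b ≤ ∑ μ : Fin ν, (suTwoPointB N ν L β 0 (Pi.single μ 1) + suTwoPointB N ν L β 0 (-Pi.single μ 1))) :
    suJB N ν L β 1 ≠ 0 := by
  intro h0
  have h : ∀ x y : TorusSite ν L, suTwoPointB N ν L β x y = 0 := fun x y => by
    rw [suTwoPointB, h0, div_zero, Complex.zero_re]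
  simp only [h, add_zero, Finset.sum_const_zero] at hSD
  linarith

/-! ### The reduction: chiral long-range order at small `β > 0` for `SU(N)` from the Schwinger–Dyson bound alone -/

/-- **REDUCTION OF «`SU(N)`, SMALL `β > 0`, CHIRAL LRO» TO THE SCHWINGER–DYSON BOUND.**  For every `N ≥ 1` and
`ν ≥ 4`: if for some `b` with `2·4N·S(ν) < b` the Schwinger–Dyson bound `∑_μ (T_β(0,e_μ) + T_β(0,−e_μ)) ≥ b`
holds for all `0 ≤ β < β₀` and all even `L ≥ L₀` (any ordering of the Grassmann generators), then there are
`c > 0` and `L₁` with `|Λ|⁻¹∑_x T_β(0,x) ≥ c` for all `0 ≤ β < β₀` and all even `L ≥ L₁`.  The infrared side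
(`infraredBound_SUB'`: twisted reflection positivity with the all-colour certificate at every `β ≥ 0`, Gaussian
domination, lattice symmetries by slab sign flips), translation invariance, the chiral grading and `Z_β ≠ 0` are
all theorems; at `β = 0` and `N` odd `≥ 3` the Schwinger–Dyson bound is the theorem
`sum_suTwoPoint_nbr_ge` (`b = 4N`, `suTwoPointB_zero`), whence `chiralLRO_SU`.  THE ONE MISSING INPUT for
«`SU(3)`, one massless staggered flavour, small `β > 0`: chiral LRO» is thus a volume-uniform Schwinger–Dyson
lower bound for `SU(N)` at small `β > 0` — not in print. [cite: SalmhoferSeiler1991, Thm. 4.8, Cor. 4.9 (4.41)–(4.42) and §5 p. 424] -/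
theorem chiralLRO_SU_of_SD (hN0 : N ≠ 0) (hν : 4 ≤ ν) {β₀ b : ℝ} (hb : 2 * (4 * (N : ℝ)) * fluctS ν < b) {L₀ : ℕ}
    (hSD : ∀ β : ℝ, 0 ≤ β → β < β₀ → ∀ (L : ℕ) [NeZero L] [LinearOrder (TorusSite ν L)], Even L → L₀ ≤ L →
      b ≤ ∑ μ : Fin ν, (suTwoPointB N ν L β 0 (Pi.single μ 1) + suTwoPointB N ν L β 0 (-Pi.single μ 1))) :
    ∃ c : ℝ, 0 < c ∧ ∃ L₁ : ℕ, ∀ β : ℝ, 0 ≤ β → β < β₀ →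
      ∀ (L : ℕ) [NeZero L] [LinearOrder (TorusSite ν L)], Even L → L₁ ≤ L → c ≤ suChiralOrderB N ν L β := by
  have hν3 : 3 ≤ ν := by omega
  have hν1 : 1 ≤ ν := by omega
  haveI : NeZero ν := ⟨by omega⟩
  have hA : (0 : ℝ) ≤ 4 * N := by positivity
  have hb0 : 0 < b := lt_of_le_of_lt (mul_nonneg (by positivity) (fluctS_nonneg ν)) hb
  obtain ⟨c, hc, L₁, hL₁⟩ := ComplexSpin.kernel_chiralLRO_uniform (ν := ν) hν3 hA hb
  refine ⟨c, hc, max L₁ L₀, fun β hβ hββ₀ L _ _ hE hLe => ?_⟩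
  have hSD' := hSD β hβ hββ₀ L hE (le_of_max_le_right hLe)
  have hZ : suJB N ν L β 1 ≠ 0 := suJB_one_ne_zero_of_SD hb0 hSD'
  have h := hL₁ L hE (le_of_max_le_left hLe) (fun x y => suTwoPointB N ν L β x y)
    (fun x y a => suTwoPointB_add hN0 hE hZ x y a) (fun x y => suTwoPointB_comm β x y)
    (fun z hz => by
      refine suTwoPointB_eq_zero_of_sgn_eq hE β ?_
      rw [ComplexSpin.sgn_zero]
      unfold ComplexSpin.sgn
      rw [if_pos hz])
    (fun χ _ _ => infraredBound_SUB' hN0 hE hβ hZ χ) hSD'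
  unfold suChiralOrderB
  exact h

end MesonWeightSU

end Summit.Ventures.YMGap.Conjectures

end
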